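import Mathlib
import HarnessLib
import Summits.AnomalousDissipation.AnomalousDissipation.Theses.ImpulseGrid

/-!
# Crux GridSignsLaw (stmt-AnomalousDissipation-14349) — ideator 2, round 1: first lemmas of the two idea cards

* `ConveyorMomentumBudget` — first lemma of card `conveyor-relative-energy`: the full family of
  exact circuit budgets obtained by testing the mean momentum balance with `χ(x₀) • H(x⊥)`
  (every smooth streamwise weight `χ`, every smooth transverse `x₀`-independent divergence-free
  pattern `H ⊥ e₀`). `χ = Ψ, H = G` and `χ = 1, H = G` are the two conjuncts of the route's
  `GridInjectionIdentity`; general `χ` gives the distributional profile budget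
  `(cJ + S)' = R + Φ‖G‖²` along the circuit used by the card.
* `KickedDipoleEuler` — first lemma of card `swimming-dipole-dilution`: if the transverse pattern
  `G` is a travelling wave of 2-D Euler (speed `V` along `e₁`), the kicked column `c e₀ + c⁻¹ G`
  evolves under EXACT Euler dynamics as the swimming dipole `c e₀ + c⁻¹ G(· − (tV/c) e₁)`; its
  correlation with `G` is the autocorrelation `A(tV/c)/c` (toy j016913).
Both are stated over existing declarations only; neither is proved here.
-/

namespace Summit.AnomalousDissipation.AnomalousDissipation.Cruxes.GridSignsLaw.Ideator2

open MeasureTheory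

local notation "𝕋³" => UnitAddTorus (Fin 3)
local notation "E³" => EuclideanSpace ℝ (Fin 3)

/-- CONVEYOR MOMENTUM BUDGET (first lemma, card `conveyor-relative-energy`). For the grid force
`Φ(x₀) • G(x⊥)`, any constant `c`, `w := u − c e₀`, any smooth streamwise weight `χ = χ(x₀)` and any
smooth transverse test pattern `H` (`x₀`-independent, `H ⊥ e₀`, `div H = 0`, so `χ • H` is an
admissible divergence-free steady test field), every global Leray–Hopf solution with a sup-in-time
energy bound satisfies, in any generalized long-time limit `Λ`,
`c Λ⟨∫ ∂₀χ ⟪H, w⟫⟩ + Λ⟨∫ ⟪w, (w·∇)(χH)⟫⟩ + ν Λ⟨(u, Δ(χH))⟩ + ∫ χ Φ ⟪G, H⟫ = 0`.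
Proof route: `ImpulseGrid.MeanMomentumBalance` with `Φ₀ = χ • H` and the pointwise algebra
`⟪u, (u·∇)(χH)⟫ = c ∂₀χ ⟪w, H⟫ + ⟪w, (w·∇)(χH)⟫` (uses only `H₀ = 0`, `∂₀H = 0`). -/
def ConveyorMomentumBudget : Prop :=
  ∀ (Λ : Literature.Analysis.FluidPDE.GeneralizedLimit) (ν c : ℝ) (Φ χ : 𝕋³ → ℝ)
    (G H : 𝕋³ → E³) (u₀ : 𝕋³ → E³) (u : ℝ → 𝕋³ → E³),
    0 < ν →
    Literature.Analysis.FunctionSpaces.Torus.IsSmooth Φ →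
    Literature.Analysis.FunctionSpaces.Torus.IsSmooth χ →
    Literature.Analysis.FunctionSpaces.Torus.IsSmooth G →
    Literature.Analysis.FunctionSpaces.Torus.IsSmooth H →
    (∀ (s : UnitAddCircle) x, χ (x + Pi.single (1 : Fin 3) s) = χ x ∧ χ (x + Pi.single (2 : Fin 3) s) = χ x) →
    (∀ (s : UnitAddCircle) x, G (x + Pi.single (0 : Fin 3) s) = G x) →
    (∀ (s : UnitAddCircle) x, H (x + Pi.single (0 : Fin 3) s) = H x) →
    (∀ x, H x 0 = 0) →
    Literature.Analysis.FunctionSpaces.Torus.IsDivFree H →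
    Literature.Analysis.FluidPDE.Torus.IsGlobalLerayHopf ν (fun _ => fun x => Φ x • G x) u₀ u →
    (∃ C : ℝ, ∀ t : ℝ, 0 ≤ t → Literature.Analysis.FunctionSpaces.Torus.kineticEnergy (u t) ≤ C) →
    c * Λ.longTimeAvg (fun t => ∫ x,
          Literature.Analysis.FunctionSpaces.Torus.partialDeriv 0 χ x *
            inner ℝ (H x) (u t x - c • EuclideanSpace.single 0 1))
      + Λ.longTimeAvg (fun t => ∫ x, inner ℝ (u t x - c • EuclideanSpace.single 0 1)
          (Literature.Analysis.FunctionSpaces.Torus.convect (fun y => u t y - c • EuclideanSpace.single 0 1)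
            (fun y => χ y • H y) x))
      + ν * Λ.longTimeAvg (fun t => ∫ x, inner ℝ (u t x)
          (Literature.Analysis.FunctionSpaces.Torus.laplacian (fun y => χ y • H y) x))
      + ∫ x, χ x * Φ x * inner ℝ (G x) (H x) = 0

/-- KICKED DIPOLE IS EXACT EULER (first lemma, card `swimming-dipole-dilution`). Let the transverse
pattern `G` (`x₀`-independent, `G ⊥ e₀`, divergence-free, smooth) be a travelling wave of the 2-D
Euler equations with speed `V` along `e₁` and co-moving pressure `q`:
`(G·∇)G − V ∂₁G = −∇q`. Then for every drift `c ≠ 0` the kicked column, started from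
`c e₀ + c⁻¹ G`, is carried by the EXACT classical Euler flow
`U(t, x) = c e₀ + c⁻¹ G(x − (tV/c) e₁)` with pressure `c⁻² q(x − (tV/c) e₁)`:
`∂ₜU + (U·∇)U = −c⁻² ∇(q ∘ shift)`, `div U = 0`, and its correlation with the force pattern is
the autocorrelation `⟪G, U(t)⟫_{L²} = c⁻¹ ∫ ⟪G x, G(x − (tV/c)e₁)⟫` (the deterministic,
turbulence-free relaxation of the imprint by self-propulsion). Pure calculus over the tree's torus
derivatives. -/
def KickedDipoleEuler : Prop :=
  ∀ (G : 𝕋³ → E³) (q : 𝕋³ → ℝ) (c V : ℝ),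
    Literature.Analysis.FunctionSpaces.Torus.IsSmooth G →
    Literature.Analysis.FunctionSpaces.Torus.IsSmooth q →
    (∀ (s : UnitAddCircle) x, G (x + Pi.single (0 : Fin 3) s) = G x) →
    (∀ (s : UnitAddCircle) x, q (x + Pi.single (0 : Fin 3) s) = q x) →
    (∀ x, G x 0 = 0) →
    Literature.Analysis.FunctionSpaces.Torus.IsDivFree G →
    c ≠ 0 →
    (∀ x, Literature.Analysis.FunctionSpaces.Torus.convect G G x
        - V • Literature.Analysis.FunctionSpaces.Torus.partialDeriv 1 G x
        = -Literature.Analysis.FunctionSpaces.Torus.gradient q x) →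
    let shift : ℝ → 𝕋³ → 𝕋³ := fun t x => x - Pi.single (1 : Fin 3) (((t * V / c : ℝ) : UnitAddCircle))
    let U : ℝ → 𝕋³ → E³ := fun t x => c • EuclideanSpace.single 0 1 + c⁻¹ • G (shift t x)
    (∀ t, Literature.Analysis.FunctionSpaces.Torus.IsDivFree (U t)) ∧
    (∀ t x, deriv (fun s => U s x) t + Literature.Analysis.FunctionSpaces.Torus.convect (U t) (U t) x
        = -(c⁻¹ ^ 2) • Literature.Analysis.FunctionSpaces.Torus.gradient (fun y => q (shift t y)) x) ∧
    (∀ t, ∫ x, inner ℝ (G x) (U t x) = c⁻¹ * ∫ x, inner ℝ (G x) (G (shift t x)))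

end Summit.AnomalousDissipation.AnomalousDissipation.Cruxes.GridSignsLaw.Ideator2
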